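import Literature.Geometry.Riemannian.ParabolicNhdSliceVolume
import Literature.Geometry.Riemannian.LowerVolumeBoundHCenter
import Literature.Geometry.Riemannian.KernelNashEntropyMonotone
import Mathlib.Combinatorics.Pigeonhole
import HarnessLib

/-!
# Packing by `P*`-parabolic balls (Bamler 2020a, §9.1, arXiv v1 Thm. 36, the cardinality bound)

R. Bamler, *Entropy and heat kernel bounds on a Ricci flow background*, arXiv:2008.07093 (2020a),
§9.1, arXiv v1 Thm. 36 (covering by `P*`-parabolic balls): for `λ₀ > 0`, `A, T^± ≥ 0`, a point
`(x₀, t₀)` and a scale `r > 0` with `[t₀ − (T⁻ + λ₀²) r², t₀] ⊂ I`, every subset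
`X ⊂ P*(x₀, t₀; A r, −T⁻ r², T⁺ r²)` and `λ ∈ (0, λ₀]` admit points `(y_1, s_1), …, (y_N, s_N) ∈ X`
with `X ⊂ ⋃ᵢ P*(y_i, s_i; λ r)` and `N ≤ C(A, T⁻, T⁺, λ₀) λ^{−n−2}`. The printed proof (§9.2)
takes a maximal family of points of `X` whose balls `P*(y_i, s_i; λ r)` are pairwise disjoint
(covering then follows from Prop. 9.3 (d)) and BOUNDS ITS CARDINALITY; this file proves that
cardinality (packing) bound for the metric flow `𝒳 = ricciFlowMetricFlow hh hR _ hflow` of a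
Ricci flow on a closed manifold, in the tree's vocabulary (`MetricFlow.pParabolicNhd`,
`MetricFlow.pParabolicBall`, `MetricFlow.IsHCenter`):

* `exists_card_mul_pow_le_of_disjoint_pParabolicBall` — **the theorem**: for `m ≥ 3`, `Λ ≥ 0`,
  `A, T⁻, T⁺ ≥ 0`, `λ₀ > 0` there is `C = C(m, Λ, A, T⁻, T⁺, λ₀)` such that for every such flow
  on `[a, T]`, `x₀`, `t₀`, `r > 0` with `a < t₀ − (T⁻ + 2λ₀²) r²`, `t₀ + T⁺ r² < T`, `R ≥ R_min` on
  `M × [t₀ − (T⁻ + 2λ₀²) r², t₀ + T⁺ r²]`, `−R_min (T⁻ + 2λ₀² + T⁺) r² ≤ Λ`, every `λ ∈ (0, λ₀]`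
  and all points `p_1, …, p_N ∈ P*(x₀, t₀; A r, −T⁻ r², T⁺ r²)` with pairwise disjoint
  `P*(p_i; λ r)`: `N λ^{m+2} ≤ C`.

The proof is the printed one, assembled from the tree's bricks:
* `exists_time_pigeonhole` — a time `t*` with `t* ∈ [s_i − 2βλ²r², s_i − βλ²r²]` for all `i`
  in a sub-family `ℐ`, `N ≤ C λ^{−2} |ℐ|` (`β = 1/(64 H_m)`);
* `MetricFlow.IsHConcentrated.ofReal_le_wassersteinW1_of_disjoint_pParabolicBall` — disjoint
  balls have `d^{t*}_{W₁}(ν_{p_i;t*}, ν_{p_j;t*}) ≥ λ r` (monotonicity of `d_{W₁}`, §2.4);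
* `MetricFlow.IsHCenter.wassersteinW1_condKernel_le_edist_add` — hence `H_m`-centres `z_i` of
  the `p_i` at time `t*` (Bamler 2023, §3.4) are `λr/2`-separated, the balls `B_{t*}(z_i, λr/4)`
  pairwise disjoint;
* the lower volume bound at `H_m`-centres, Thm. 6.2 (`riemVolume_ball_ge_of_hCenter`,
  `LowerVolumeBoundHCenter.lean`), with the entropy moved to `(x₀, t₀)` by Prop. 5.2 and
  Cor. 5.11 (`kernelNashEntropy_sub_le_kernelNashEntropy_of_wassersteinW1_le`, from
  `KernelNashEntropyMonotone.lean`, `KernelNashEntropyW1Bound.lean`):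
  `|B_{t*}(z_i, λr/4)|_{t*} ≥ c λᵐ rᵐ exp(𝒩*_{s₁}(x₀, t₀))`, `s₁ = t₀ − (T⁻ + 2λ₀²) r²`;
* `MetricFlow.IsHConcentrated.wassersteinW1_condKernel_le_of_isHCenter` — the balls lie in the
  time-`t*` slice of `P*(x₀, t₀; (A + λ₀) r, −(T⁻ + λ₀²) r², T⁺ r²)`, whose volume is
  `≤ C rᵐ exp(𝒩*_{s₁}(x₀, t₀))` by arXiv v1 Thm. 35 (`exists_riemVolume_pParabolicNhdSlice_le`,
  `ParabolicNhdSliceVolume.lean`); summing, `|ℐ| ≤ C λ^{−m}`.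

Everything is proved; no definitions, no named facts. What is NOT here: the extraction of a
maximal disjoint family and the covering conclusion `X ⊂ ⋃ᵢ P*(p_i; λ r)` itself.

## References

* R. H. Bamler, *Entropy and heat kernel bounds on a Ricci flow background*, arXiv:2008.07093
  (2020), §9.1, arXiv v1 Thm. 36 and its proof in §9.2; §5.1, Prop. 5.2, Cor. 5.11; §6.1,
  Thm. 6.2; arXiv v1 Thm. 35. [Bamler2020Entropy]
* R. H. Bamler, *Compactness theory of the space of super Ricci flows*, Invent. Math. 233 (2023),
  1121–1277, §3.4 (`H`-centres), §3.5 (`P*`-parabolic neighbourhoods). [Bamler2023]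
-/

noncomputable section

open Set Filter Function MeasureTheory Measure
open scoped Manifold ContDiff Topology ENNReal NNReal

namespace Literature.Geometry.Riemannian

open Lorentzian Lorentzian.PseudoRiemannianMetric

/-! ### Metric-flow lemmas -/

namespace MetricFlow

universe u

variable {I : Set ℝ} {𝒳 : MetricFlow.{u} I} {H : ℝ}

/-- **The `W₁`-distance of two conjugate heat kernels is at most the distance of their
`H`-centres plus `√(H(t₁ − s)) + √(H(t₂ − s))`** (Bamler 2020a, §9.2, proof of arXiv v1 Thm. 36,
the display "`d_{t*}(z_i, z_j) ≥ d_{W₁}(ν_{y_i,s_i;t*}, ν_{y_j,s_j;t*}) − d_{W₁}(δ_{z_i}, ν_{y_i,s_i;t*})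
− d_{W₁}(δ_{z_j}, ν_{y_j,s_j;t*})`", rearranged without subtraction): for `H`-centres `zᵢ ∈ 𝒳_s`
of `xᵢ ∈ 𝒳_{tᵢ}`, `d_{W₁}(ν_{x₁;s}, ν_{x₂;s}) ≤ √(H(t₁ − s)) + d_s(z₁, z₂) + √(H(t₂ − s))`.
[cite: Bamler2020Entropy, §9.2, proof of arXiv v1 Thm. 36] -/
theorem IsHCenter.wassersteinW1_condKernel_le_edist_add {s t₁ t₂ : I} {x₁ : 𝒳.Slice t₁}
    {x₂ : 𝒳.Slice t₂} {z₁ z₂ : 𝒳.Slice s} (hz₁ : 𝒳.IsHCenter H z₁ x₁)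
    (hz₂ : 𝒳.IsHCenter H z₂ x₂) :
    wassersteinW1 (𝒳.condKernel x₁ s) (𝒳.condKernel x₂ s) ≤
      (ENNReal.ofReal (H * ((t₁ : ℝ) - s))) ^ (1 / 2 : ℝ) + edist z₁ z₂ +
        (ENNReal.ofReal (H * ((t₂ : ℝ) - s))) ^ (1 / 2 : ℝ) := by
  haveI := 𝒳.isProbabilityMeasure_condKernel x₁ hz₁.1
  haveI := 𝒳.isProbabilityMeasure_condKernel x₂ hz₂.1
  calc wassersteinW1 (𝒳.condKernel x₁ s) (𝒳.condKernel x₂ s)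
      ≤ wassersteinW1 (𝒳.condKernel x₁ s) (Measure.dirac z₁) +
          wassersteinW1 (Measure.dirac z₁) (𝒳.condKernel x₂ s) := wassersteinW1_triangle _ _ _
    _ ≤ wassersteinW1 (𝒳.condKernel x₁ s) (Measure.dirac z₁) +
          (wassersteinW1 (Measure.dirac z₁) (Measure.dirac z₂) +
            wassersteinW1 (Measure.dirac z₂) (𝒳.condKernel x₂ s)) :=
        add_le_add le_rfl (wassersteinW1_triangle _ _ _)
    _ ≤ (ENNReal.ofReal (H * ((t₁ : ℝ) - s))) ^ (1 / 2 : ℝ) +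
          (edist z₁ z₂ + (ENNReal.ofReal (H * ((t₂ : ℝ) - s))) ^ (1 / 2 : ℝ)) := by
        refine add_le_add ?_ (add_le_add (wassersteinW1_dirac_dirac z₁ z₂).le
          hz₂.wassersteinW1_dirac_le)
        rw [wassersteinW1_comm]
        exact hz₁.wassersteinW1_dirac_le
    _ = _ := (add_assoc _ _ _).symm

/-- **Disjoint `P*`-parabolic balls of the same radius have `W₁`-separated kernels** (Bamler
2020a, §9.2, proof of arXiv v1 Thm. 36: "`d_{W₁}^{t*}(ν_{y_i,s_i;t*}, ν_{y_j,s_j;t*}) ≥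
d_{W₁}^{s_i−λ²}(ν_{y_i,s_i;s_i−λ²}, ν_{y_j,s_j;s_i−λ²}) ≥ λ`"): in an `H`-concentrated metric
flow, if `P*(p₁; ρ) ∩ P*(p₂; ρ) = ∅` (`ρ > 0`), `𝔱(p₂) ≤ 𝔱(p₁) + ρ²`, and
`𝔱(p₁) − ρ² ≤ t ≤ min(𝔱(p₁), 𝔱(p₂))`, then `ρ ≤ d^{t}_{W₁}(ν_{p₁;t}, ν_{p₂;t})` — otherwise, by the
monotonicity of `d_{W₁}` (§2.4), `p₂ ∈ P*(p₁; ρ) ∩ P*(p₂; ρ)`.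
[cite: Bamler2020Entropy, §9.2, proof of arXiv v1 Thm. 36] -/
theorem IsHConcentrated.ofReal_le_wassersteinW1_of_disjoint_pParabolicBall
    (hH : 𝒳.IsHConcentrated H) {p₁ p₂ : 𝒳.Pt} {ρ : ℝ} (hρ : 0 < ρ)
    {h₁ : (p₁.1 : ℝ) - ρ ^ 2 ∈ I} {h₂ : (p₂.1 : ℝ) - ρ ^ 2 ∈ I}
    (hd : Disjoint (𝒳.pParabolicBall p₁ ρ h₁) (𝒳.pParabolicBall p₂ ρ h₂)) {t : I}
    (h1t : (p₁.1 : ℝ) - ρ ^ 2 ≤ t) (ht1 : (t : ℝ) ≤ p₁.1) (ht2 : (t : ℝ) ≤ p₂.1)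
    (h21 : (p₂.1 : ℝ) ≤ p₁.1 + ρ ^ 2) :
    ENNReal.ofReal ρ ≤ wassersteinW1 (𝒳.condKernel p₁.2 t) (𝒳.condKernel p₂.2 t) := by
  by_contra hlt
  rw [not_le] at hlt
  have hmem : p₂ ∈ 𝒳.pParabolicBall p₁ ρ h₁ :=
    ⟨⟨by linarith, h21⟩, (hH.wassersteinW1_condKernel_mono' h1t ht1 ht2 p₁.2 p₂.2).trans_lt hlt⟩
  exact Set.disjoint_left.1 hd hmem (𝒳.mem_pParabolicBall_self p₂ hρ h₂)

/-- **Points near an `H`-centre of a point of `P*(x₀; A, −T⁻, T⁺)` lie in a slightly larger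
`P*`-neighbourhood** (Bamler 2020a, §9.2, proof of arXiv v1 Thm. 36, the inclusion
"`B_i ⊂ B(S_{t*}, t*, λ₀/4)`", in `W₁`-form): for `x₀ ∈ 𝒳_{t₀}`, `y ∈ 𝒳_t`, an `H`-centre
`z ∈ 𝒳_{t*}` of `y`, `w ∈ 𝒳_{t*}` and evaluation times `s₋ ≤ s₀ ≤ min(t₀, t)`, `s₋ ≤ t*`,
`d^{s₋}_{W₁}(ν_{x₀;s₋}, ν_{w;s₋}) ≤ d^{s₀}_{W₁}(ν_{x₀;s₀}, ν_{y;s₀}) + √(H(t − t*)) + d_{t*}(z, w)`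
(triangle inequality through `ν_{y;s₋}`, `ν_{z;s₋}`; monotonicity of `d_{W₁}` (§2.4);
`d_{W₁}(δ_z, ν_{y;t*}) ≤ √(H(t − t*))`; `d_{W₁}(ν_{z;s₋}, ν_{w;s₋}) ≤ d_{t*}(z, w)`).
[cite: Bamler2020Entropy, §9.2, proof of arXiv v1 Thm. 36] -/
theorem IsHConcentrated.wassersteinW1_condKernel_le_of_isHCenter (hH : 𝒳.IsHConcentrated H)
    {sm s₀ t₀ t ts : I} {x₀ : 𝒳.Slice t₀} {y : 𝒳.Slice t} {z : 𝒳.Slice ts}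
    (hz : 𝒳.IsHCenter H z y) (w : 𝒳.Slice ts) (hms₀ : (sm : ℝ) ≤ s₀) (hs₀t₀ : (s₀ : ℝ) ≤ t₀)
    (hs₀t : (s₀ : ℝ) ≤ t) (hmts : (sm : ℝ) ≤ ts) :
    wassersteinW1 (𝒳.condKernel x₀ sm) (𝒳.condKernel w sm) ≤
      wassersteinW1 (𝒳.condKernel x₀ s₀) (𝒳.condKernel y s₀) +
        (ENNReal.ofReal (H * ((t : ℝ) - ts))) ^ (1 / 2 : ℝ) + edist z w := by
  have hmt₀ : (sm : ℝ) ≤ t₀ := hms₀.trans hs₀t₀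
  have hmt : (sm : ℝ) ≤ t := hms₀.trans hs₀t
  haveI := 𝒳.isProbabilityMeasure_condKernel x₀ hmt₀
  haveI := 𝒳.isProbabilityMeasure_condKernel y hmt
  haveI := 𝒳.isProbabilityMeasure_condKernel z hmts
  haveI := 𝒳.isProbabilityMeasure_condKernel w hmts
  calc wassersteinW1 (𝒳.condKernel x₀ sm) (𝒳.condKernel w sm)
      ≤ wassersteinW1 (𝒳.condKernel x₀ sm) (𝒳.condKernel y sm) +
          wassersteinW1 (𝒳.condKernel y sm) (𝒳.condKernel w sm) := wassersteinW1_triangle _ _ _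
    _ ≤ wassersteinW1 (𝒳.condKernel x₀ sm) (𝒳.condKernel y sm) +
          (wassersteinW1 (𝒳.condKernel y sm) (𝒳.condKernel z sm) +
            wassersteinW1 (𝒳.condKernel z sm) (𝒳.condKernel w sm)) :=
        add_le_add le_rfl (wassersteinW1_triangle _ _ _)
    _ ≤ wassersteinW1 (𝒳.condKernel x₀ s₀) (𝒳.condKernel y s₀) +
          ((ENNReal.ofReal (H * ((t : ℝ) - ts))) ^ (1 / 2 : ℝ) + edist z w) := by
        refine add_le_add (hH.wassersteinW1_condKernel_mono' hms₀ hs₀t₀ hs₀t x₀ y)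
          (add_le_add ?_ (hH.wassersteinW1_condKernel_le_edist hmts z w))
        refine (hH.wassersteinW1_condKernel_mono' hmts hz.1 le_rfl y z).trans ?_
        rw [𝒳.condKernel_self, wassersteinW1_comm]
        exact hz.wassersteinW1_dirac_le
    _ = _ := (add_assoc _ _ _).symm

end MetricFlow

/-! ### Pigeonholing the times -/

/-- **Pigeonhole in time** (Bamler 2020a, §9.2, proof of arXiv v1 Thm. 36: "there is some time
`t* ∈ [t₀ − T⁻ − 2βλ², t₀ + T⁺ − βλ²]` and a subset `ℐ ⊂ {1, …, N}` with
`|ℐ| ≥ ⌊c(T⁻, T⁺, β) λ² N⌋` and `t* ∈ [s_i − 2βλ², s_i − βλ²]` for all `i ∈ ℐ`"): for `N` reals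
`s_i ∈ [lo, hi]` and `δ > 0` there are `t* ∈ [lo − 2δ, hi − δ]` and `ℐ` with
`δ ≤ s_i − t* < 2δ` for `i ∈ ℐ` and `N ≤ ((hi − lo)/δ + 2) |ℐ|` (the grid `lo − 2δ + kδ`,
`k ≤ ⌊(hi − lo + δ)/δ⌋`, meets every `[s_i − 2δ, s_i − δ]`; pigeonhole over `k`).
[cite: Bamler2020Entropy, §9.2, proof of arXiv v1 Thm. 36] -/
theorem exists_time_pigeonhole {N : ℕ} (s : Fin N → ℝ) {lo hi δ : ℝ} (hδ : 0 < δ)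
    (hlohi : lo ≤ hi) (hs : ∀ i, s i ∈ Icc lo hi) :
    ∃ tstar : ℝ, lo - 2 * δ ≤ tstar ∧ tstar ≤ hi - δ ∧ ∃ ℐ : Finset (Fin N),
      (∀ i ∈ ℐ, δ ≤ s i - tstar ∧ s i - tstar < 2 * δ) ∧
        (N : ℝ) ≤ ((hi - lo) / δ + 2) * ℐ.card := by
  classical
  set K : ℕ := ⌊(hi - lo + δ) / δ⌋₊ with hK
  set f : Fin N → ℕ := fun i ↦ ⌊(s i - lo + δ) / δ⌋₊ with hf
  have hfK : ∀ i ∈ (Finset.univ : Finset (Fin N)), f i ∈ Finset.range (K + 1) := by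
    intro i _
    rw [Finset.mem_range, Nat.lt_succ_iff, hf, hK]
    exact Nat.floor_mono (div_le_div_of_nonneg_right (by linarith [(hs i).2]) hδ.le)
  have hb : (Finset.range (K + 1)).card • ((N : ℝ) / (K + 1)) ≤
      ((Finset.univ : Finset (Fin N)).card : ℝ) := by
    rw [Finset.card_range, Finset.card_univ, Fintype.card_fin, nsmul_eq_mul]
    push_cast
    rw [mul_div_cancel₀ _ (by positivity)]
  obtain ⟨k, hk, hcard⟩ := Finset.exists_le_card_fiber_of_nsmul_le_card_of_maps_to hfK
    ⟨0, by simp⟩ hb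
  rw [Finset.mem_range, Nat.lt_succ_iff] at hk
  have hkK : (k : ℝ) ≤ (hi - lo + δ) / δ :=
    (Nat.cast_le.2 hk).trans (Nat.floor_le (by positivity))
  refine ⟨lo - 2 * δ + k * δ, by nlinarith only [hδ, (Nat.cast_nonneg k : (0 : ℝ) ≤ k)], ?_,
    Finset.univ.filter (fun i ↦ f i = k), ?_, ?_⟩
  · have : (k : ℝ) * δ ≤ hi - lo + δ := by rwa [le_div_iff₀ hδ] at hkK
    linarith only [this]
  · intro i hi'
    rw [Finset.mem_filter] at hi'
    have hfi : f i = k := hi'.2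
    have h0 : 0 ≤ (s i - lo + δ) / δ := by
      have := (hs i).1
      positivity
    have h1 : (k : ℝ) ≤ (s i - lo + δ) / δ := by rw [← hfi, hf]; exact Nat.floor_le h0
    have h2 : (s i - lo + δ) / δ < k + 1 := by
      rw [← hfi, hf]; exact Nat.lt_floor_add_one _
    rw [le_div_iff₀ hδ] at h1
    rw [div_lt_iff₀ hδ] at h2
    constructor <;> nlinarith only [h1, h2, hδ]
  · have hK1 : ((K : ℝ) + 1) ≤ (hi - lo) / δ + 2 := by
      have : (K : ℝ) ≤ (hi - lo + δ) / δ := Nat.floor_le (by positivity)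
      rw [add_div, div_self hδ.ne'] at this
      linarith only [this]
    have hc0 : (0 : ℝ) ≤ (Finset.univ.filter (fun i ↦ f i = k)).card := Nat.cast_nonneg _
    calc (N : ℝ) = ((K : ℝ) + 1) * ((N : ℝ) / (K + 1)) := by
          rw [mul_div_cancel₀ _ (by positivity)]
      _ ≤ ((K : ℝ) + 1) * (Finset.univ.filter (fun i ↦ f i = k)).card :=
          mul_le_mul_of_nonneg_left hcard (by positivity)
      _ ≤ ((hi - lo) / δ + 2) * (Finset.univ.filter (fun i ↦ f i = k)).card :=
          mul_le_mul_of_nonneg_right hK1 hc0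


/-! ### The entropy at the points of a `P*`-parabolic neighbourhood -/

section Entropy

variable {m : ℕ} {M : Type*} [TopologicalSpace M] [ChartedSpace (EuclideanSpace ℝ (Fin m)) M]
  [IsManifold 𝓘(ℝ, EuclideanSpace ℝ (Fin m)) ∞ M] [T2Space M] [CompactSpace M]
  [SecondCountableTopology M] [MeasurableSpace M] [BorelSpace M] [ConnectedSpace M]
  {h : ℝ → PseudoRiemannianMetric 𝓘(ℝ, EuclideanSpace ℝ (Fin m)) ∞ (EuclideanSpace ℝ (Fin m))
    (TangentSpace 𝓘(ℝ, EuclideanSpace ℝ (Fin m)) : M → Type _)}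
  {cov : ℝ → CovariantDerivative 𝓘(ℝ, EuclideanSpace ℝ (Fin m)) (EuclideanSpace ℝ (Fin m))
    (TangentSpace 𝓘(ℝ, EuclideanSpace ℝ (Fin m)) : M → Type _)}
  {a T : ℝ} (hflow : IsRicciFlow h cov (Icc a T)) (hh : IsContMDiffFamilyOn ∞ h univ)
  (hR : ∀ r, (h r).IsRiemannian)

/-- **The entropy based at a point `(y, s)` whose kernel is `W₁`-close to that of `(x₀, t₀)` is
bounded below by the entropy at `(x₀, t₀)`** (Bamler 2020a, §9.2, proof of arXiv v1 Thm. 36: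
"by Proposition 5.2 and Corollary 5.11, `exp(𝒩_{y_i,s_i}(λ²)) ≥ c exp(𝒩_{x₀,t₀}(…))`"): for
`a < s₁ < s₀ ≤ min(t₀, s)`, `t₀ < T`, `s ≤ T`, `s₁ ≤ t* < s`, `R_{g_{s₁}} ≥ R_min` and
`d^{g_{s₀}}_{W₁}(ν_{x₀,t₀;s₀}, ν_{y,s;s₀}) ≤ D`,
`𝒩*_{s₁}(x₀, t₀) − (m/2) log((s − s₁)/(s₀ − s₁)) − √(m/(2(s₀ − s₁)) − R_min) D ≤ 𝒩*_{t*}(y, s)`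
(Cor. 5.11 `IsRicciFlow.ofReal_kernelNashEntropy_sub_sub_le_mul_wassersteinW1` at `t* = s₀`,
then `𝒩*_{s₁}(y, s) ≤ 𝒩*_{t*}(y, s)`, Prop. 5.2 `kernelNashEntropy_mono`).
[cite: Bamler2020Entropy, §9.2, proof of arXiv v1 Thm. 36; §5.1, Prop. 5.2, Cor. 5.11] -/
theorem kernelNashEntropy_sub_le_kernelNashEntropy_of_wassersteinW1_le (hm : 3 ≤ m)
    {s₁ s₀ t₀ s tstar : ℝ} (has : a < s₁) (hs₁₀ : s₁ < s₀) (hs₀t₀ : s₀ ≤ t₀) (hs₀s : s₀ ≤ s)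
    (ht₀T : t₀ < T) (hsT : s ≤ T) (hs₁ts : s₁ ≤ tstar) (htss : tstar < s) {Rmin : ℝ}
    (hRmin : ∀ y : M, Rmin ≤ (h s₁).scalarCurvatureWith (cov s₁) y) (x₀ y : M) {D : ℝ}
    (hD : 0 ≤ D)
    (hW : (letI := (h s₀).metricSpace (hR s₀)
      wassersteinW1 (heatKernelMeasure hh hR t₀ x₀ s₀) (heatKernelMeasure hh hR s y s₀)) ≤
        ENNReal.ofReal D) :
    pointedNashEntropy h (fun r v ↦ hflow.heatKernelFn hh hR t₀ x₀ (v, r)) m t₀ s₁ -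
        (m : ℝ) / 2 * Real.log ((s - s₁) / (s₀ - s₁)) -
        Real.sqrt ((m : ℝ) / (2 * (s₀ - s₁)) - Rmin) * D ≤
      pointedNashEntropy h (fun r v ↦ hflow.heatKernelFn hh hR s y (v, r)) m s tstar := by
  have hL0 : 0 ≤ Real.sqrt ((m : ℝ) / (2 * (s₀ - s₁)) - Rmin) := Real.sqrt_nonneg _
  have hcor := hflow.ofReal_kernelNashEntropy_sub_sub_le_mul_wassersteinW1 hh hR hm has hs₁₀
    hs₀t₀ hs₀s ht₀T hsT hRmin x₀ y
  have hc := hcor.trans (mul_le_mul' le_rfl hW)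
  rw [← ENNReal.ofReal_mul hL0, ENNReal.ofReal_le_ofReal_iff (mul_nonneg hL0 hD)] at hc
  have hmono := kernelNashEntropy_mono hflow hh hR hm has hs₁ts htss hsT y
  linarith only [hc, hmono]

end Entropy

/-! ### The packing bound -/

/-- **Bamler 2020a, §9.1, arXiv v1 Thm. 36 (covering by `P*`-parabolic balls), the packing /
cardinality bound.** For `m ≥ 3`, `Λ ≥ 0`, `A, T⁻, T⁺ ≥ 0` and `λ₀ > 0` there is
`C = C(m, Λ, A, T⁻, T⁺, λ₀) > 0` such that: for every Ricci flow `hflow` on `[a, T]` of a smooth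
family of Riemannian metrics on a closed connected manifold modelled on `ℝᵐ` with metric flow
`𝒳 = ricciFlowMetricFlow hh hR _ hflow`, every `x₀ ∈ M`, `t₀`, `r > 0` with
`a < t₀ − (T⁻ + 2λ₀²) r²`, `t₀ + T⁺ r² < T`, `R ≥ R_min` on `M × [t₀ − (T⁻ + 2λ₀²) r², t₀ + T⁺ r²]`
with `−R_min (T⁻ + 2λ₀² + T⁺) r² ≤ Λ`, every `λ ∈ (0, λ₀]` and all points
`(y₁, s₁), …, (y_N, s_N) ∈ P*(x₀, t₀; A r, −T⁻ r², T⁺ r²)` whose `P*`-parabolic balls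
`P*(y_i, s_i; λ r)` are pairwise disjoint,

  `N λ^{m+2} ≤ C`,   i.e. `N ≤ C λ^{−m−2}`

— the bound on `N` in display (9.9') of the source, from which the covering statement follows by
taking a maximal such family (Prop. 9.3 (d)). Proof as printed (§9.2): pigeonhole a time
`t* ∈ [s_i − 2βλ²r², s_i − βλ²r²]` for `i ∈ ℐ`, `N ≤ C λ^{−2} |ℐ|` (`exists_time_pigeonhole`,
`β = 1/(64 H_m)`); `H_m`-centres `z_i` of `(y_i, s_i)` at `t*`; disjointness gives
`d^{t*}_{W₁}(ν_i, ν_j) ≥ λ r` (`…ofReal_le_wassersteinW1_of_disjoint_pParabolicBall`), hence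
`d_{t*}(z_i, z_j) ≥ λ r − 2√(2 H_m β) λ r` and the balls `B_{t*}(z_i, λr/4)` are pairwise disjoint
(`IsHCenter.wassersteinW1_condKernel_le_edist_add`); each has volume
`≥ c λᵐ rᵐ exp(𝒩*(x₀, t₀))` (Thm. 6.2 `riemVolume_ball_ge_of_hCenter`, Prop. 5.2, Cor. 5.11:
`kernelNashEntropy_sub_le_kernelNashEntropy_of_wassersteinW1_le`), and all lie in the time-`t*`
slice of `P*(x₀, t₀; (A + λ₀) r, −(T⁻ + λ₀²) r², T⁺ r²)`
(`IsHConcentrated.wassersteinW1_condKernel_le_of_isHCenter`), whose volume is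
`≤ C rᵐ exp(𝒩*(x₀, t₀))` (arXiv v1 Thm. 35, `exists_riemVolume_pParabolicNhdSlice_le`); so
`|ℐ| ≤ C λ^{−m}`. [cite: Bamler2020Entropy, §9.1, arXiv v1 Thm. 36; §9.2, proof of Thm. 36] -/
theorem exists_card_mul_pow_le_of_disjoint_pParabolicBall (m : ℕ) (hm : 3 ≤ m)
    {Λ A Tm Tp l₀ : ℝ} (hΛ : 0 ≤ Λ) (hA : 0 ≤ A) (hTm : 0 ≤ Tm) (hTp : 0 ≤ Tp) (hl₀ : 0 < l₀) :
    ∃ C : ℝ, 0 < C ∧ ∀ {M : Type*} [TopologicalSpace M]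
      [ChartedSpace (EuclideanSpace ℝ (Fin m)) M]
      [IsManifold 𝓘(ℝ, EuclideanSpace ℝ (Fin m)) ∞ M] [T2Space M] [CompactSpace M]
      [SecondCountableTopology M] [MeasurableSpace M] [BorelSpace M] [ConnectedSpace M]
      {h : ℝ → PseudoRiemannianMetric 𝓘(ℝ, EuclideanSpace ℝ (Fin m)) ∞ (EuclideanSpace ℝ (Fin m))
        (TangentSpace 𝓘(ℝ, EuclideanSpace ℝ (Fin m)) : M → Type _)}
      {cov : ℝ → CovariantDerivative 𝓘(ℝ, EuclideanSpace ℝ (Fin m)) (EuclideanSpace ℝ (Fin m))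
        (TangentSpace 𝓘(ℝ, EuclideanSpace ℝ (Fin m)) : M → Type _)}
      {a T : ℝ} (hflow : IsRicciFlow h cov (Icc a T)) (hh : IsContMDiffFamilyOn ∞ h univ)
      (hR : ∀ r, (h r).IsRiemannian),
      ∀ {t₀ r : ℝ} (ht₀ : t₀ ∈ Icc a T) (hb : t₀ - Tm * r ^ 2 ∈ Icc a T),
      0 < r → a < t₀ - (Tm + 2 * l₀ ^ 2) * r ^ 2 → t₀ + Tp * r ^ 2 < T →
      ∀ {Rmin : ℝ}, (∀ s ∈ Icc (t₀ - (Tm + 2 * l₀ ^ 2) * r ^ 2) (t₀ + Tp * r ^ 2), ∀ z : M,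
        Rmin ≤ (h s).scalarCurvatureWith (cov s) z) →
      -Rmin * ((Tm + 2 * l₀ ^ 2 + Tp) * r ^ 2) ≤ Λ → ∀ (x₀ : M) {l : ℝ}, 0 < l → l ≤ l₀ →
      ∀ {N : ℕ} (p : Fin N → (ricciFlowMetricFlow hh hR Set.ordConnected_Icc hflow).Pt)
        (hI : ∀ i, ((p i).1 : ℝ) - (l * r) ^ 2 ∈ Icc a T),
      (∀ i, p i ∈ (ricciFlowMetricFlow hh hR Set.ordConnected_Icc hflow).pParabolicNhd
        ⟨⟨t₀, ht₀⟩, x₀⟩ (A * r) (Tm * r ^ 2) (Tp * r ^ 2) hb) →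
      (∀ i j, i ≠ j → Disjoint
        ((ricciFlowMetricFlow hh hR Set.ordConnected_Icc hflow).pParabolicBall (p i) (l * r) (hI i))
        ((ricciFlowMetricFlow hh hR Set.ordConnected_Icc hflow).pParabolicBall (p j) (l * r)
          (hI j))) →
      (N : ℝ) * l ^ (m + 2) ≤ C := by
  classical
  /- constants -/
  set H : ℝ := MetricFlow.concentrationConst m with hHdef
  have hH4 : 4 ≤ H := by
    have h3 : (3 : ℝ) ≤ m := by exact_mod_cast hm
    have h1 : 0 ≤ ((m : ℝ) - 1) * Real.pi ^ 2 / 2 :=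
      div_nonneg (mul_nonneg (by linarith only [h3]) (sq_nonneg _)) zero_le_two
    rw [hHdef, MetricFlow.concentrationConst]
    linarith only [h1]
  have hH0 : 0 < H := by linarith only [hH4]
  set β : ℝ := 1 / (64 * H) with hβ
  have hβ0 : 0 < β := by positivity
  have hHβ : H * β = 1 / 64 := by
    rw [hβ]
    field_simp [hH0.ne']
  have hβ1 : 2 * β ≤ 1 := by
    have : β ≤ 1 / 256 := by
      rw [hβ, div_le_div_iff₀ (by positivity) (by norm_num)]
      linarith only [hH4]
    linarith only [this]
  have hl₀2 : 0 < l₀ ^ 2 := pow_pos hl₀ 2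
  set Q : ℝ := (Tm + Tp + 2 * l₀ ^ 2) / (2 * l₀ ^ 2) with hQ
  have hQ1 : 1 ≤ Q := by
    rw [hQ, le_div_iff₀ (by positivity), one_mul]
    linarith only [hTm, hTp]
  set E₁ : ℝ := Real.sqrt ((m : ℝ) / 2 + Λ) / Real.sqrt (2 * l₀ ^ 2) * A with hE₁
  set c₈ : ℝ := Real.exp (-((m : ℝ) / 2 * Real.log Q + E₁)) with hc₈
  have hc₈0 : 0 < c₈ := Real.exp_pos _
  set c₆ : ℝ := 1 / 2 * (4 * Real.pi * β) ^ ((m : ℝ) / 2) * Real.exp ((m : ℝ) / 2) *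
    Real.exp (-2 * Real.sqrt ((m : ℝ) + 2 * Λ)) with hc₆
  have hc₆0 : 0 < c₆ := by positivity
  set K₁ : ℝ := (Tm + Tp) / β + 2 * l₀ ^ 2 with hK₁
  have hK₁0 : 0 < K₁ := by positivity
  obtain ⟨CS, hCS, VOL⟩ := exists_riemVolume_pParabolicNhdSlice_le m hm (A + l₀) Tp (Λ := Λ)
    (Tm := Tm + l₀ ^ 2) (α := l₀ ^ 2) hΛ (by positivity) hl₀2
  refine ⟨K₁ * CS / (c₆ * c₈), by positivity, ?_⟩
  intro M _ _ _ _ _ _ _ _ _ h cov a T hflow hh hR t₀ r ht₀ hb hr hs₁a hTT Rmin hRmin hRΛ x₀ l hl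
    hll₀ N p hI hp hdisj
  /- elementary facts about the times -/
  have hr2 : 0 < r ^ 2 := pow_pos hr 2
  have hl2 : 0 < l ^ 2 := pow_pos hl 2
  have hll : l ^ 2 ≤ l₀ ^ 2 := pow_le_pow_left₀ hl.le hll₀ 2
  have hlr2 : (l * r) ^ 2 = l ^ 2 * r ^ 2 := mul_pow l r 2
  set s₀ : ℝ := t₀ - Tm * r ^ 2 with hs₀
  set sm : ℝ := t₀ - (Tm + l₀ ^ 2) * r ^ 2 with hsm
  set s₁ : ℝ := t₀ - (Tm + 2 * l₀ ^ 2) * r ^ 2 with hs₁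
  let 𝒳 : MetricFlow (Icc a T) := ricciFlowMetricFlow hh hR Set.ordConnected_Icc hflow
  have hsm' : sm = s₀ - l₀ ^ 2 * r ^ 2 := by rw [hsm, hs₀]; ring
  have hs₁' : s₁ = sm - l₀ ^ 2 * r ^ 2 := by rw [hs₁, hsm]; ring
  have hs₁s₀ : s₀ - s₁ = 2 * l₀ ^ 2 * r ^ 2 := by rw [hs₀, hs₁]; ring
  have hl₀r : 0 < l₀ ^ 2 * r ^ 2 := mul_pos hl₀2 hr2
  have hs₁sm : s₁ ≤ sm := by linarith only [hs₁', hl₀r]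
  have hsms₀ : sm ≤ s₀ := by linarith only [hsm', hl₀r]
  have hs₁₀ : s₁ < s₀ := by linarith only [hs₁s₀, hl₀r]
  have ht₀s₀ : t₀ - s₀ = Tm * r ^ 2 := by rw [hs₀]; ring
  have hs₀t₀ : s₀ ≤ t₀ := by nlinarith only [ht₀s₀, hTm, hr2]
  have hTpr : 0 ≤ Tp * r ^ 2 := mul_nonneg hTp hr2.le
  have ht₀T : t₀ < T := by linarith only [hTT, hTpr]
  have hslab : t₀ + Tp * r ^ 2 - s₁ = (Tm + 2 * l₀ ^ 2 + Tp) * r ^ 2 := by rw [hs₁]; ring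
  have hsm_mem : sm ∈ Icc a T := ⟨(hs₁a.trans_le hs₁sm).le, (hsms₀.trans hs₀t₀).trans ht₀T.le⟩
  -- the scalar curvature budget
  have hbudget : ∀ τ : ℝ, 0 ≤ τ → τ ≤ (Tm + 2 * l₀ ^ 2 + Tp) * r ^ 2 → -Rmin * τ ≤ Λ := by
    intro τ hτ0 hτ
    rcases le_or_gt 0 Rmin with h0 | h0
    · have h1 : 0 ≤ Rmin * τ := mul_nonneg h0 hτ0
      linarith only [h1, hΛ]
    · have h1 : -Rmin * τ ≤ -Rmin * ((Tm + 2 * l₀ ^ 2 + Tp) * r ^ 2) :=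
        mul_le_mul_of_nonneg_left hτ (by linarith only [h0])
      exact h1.trans hRΛ
  have hRmin₁ : ∀ y : M, Rmin ≤ (h s₁).scalarCurvatureWith (cov s₁) y :=
    fun y ↦ hRmin s₁ ⟨le_rfl, by linarith only [hs₁₀, hs₀t₀, hTpr]⟩ y
  /- the points: times and `W₁`-closeness to `(x₀, t₀)` -/
  set si : Fin N → ℝ := fun i ↦ ((p i).1 : ℝ) with hsi
  set sb : Icc a T := ⟨s₀, hb⟩
  have hpt : ∀ i, s₀ ≤ si i ∧ si i ≤ t₀ + Tp * r ^ 2 := fun i ↦ (hp i).1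
  have hpW : ∀ i, wassersteinW1 (𝒳.condKernel (t := ⟨t₀, ht₀⟩) x₀ sb)
      (𝒳.condKernel (p i).2 sb) < ENNReal.ofReal (A * r) := fun i ↦ (hp i).2
  have hsiT : ∀ i, si i ≤ T := fun i ↦ (p i).1.2.2
  /- pigeonholing the times -/
  set δ : ℝ := β * l ^ 2 * r ^ 2 with hδ
  have hδ0 : 0 < δ := by positivity
  have h2δ : 2 * δ ≤ l ^ 2 * r ^ 2 := by
    have : 2 * δ = (2 * β) * (l ^ 2 * r ^ 2) := by rw [hδ]; ring
    rw [this]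
    exact (mul_le_mul_of_nonneg_right hβ1 (by positivity)).trans_eq (one_mul _)
  have hδl₀ : 2 * δ ≤ l₀ ^ 2 * r ^ 2 := h2δ.trans (mul_le_mul_of_nonneg_right hll hr2.le)
  obtain ⟨tstar, hlo, hhi, ℐ, hℐ, hNle⟩ := exists_time_pigeonhole si hδ0
    (by linarith only [hs₀t₀, hTpr] : s₀ ≤ t₀ + Tp * r ^ 2) hpt
  have hsmts : sm ≤ tstar := by linarith only [hsm', hδl₀, hlo]
  have hts_hi : tstar ≤ t₀ + Tp * r ^ 2 := by linarith only [hhi, hδ0]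
  have hs₁ts : s₁ ≤ tstar := hs₁sm.trans hsmts
  have hats : a < tstar := hs₁a.trans_le hs₁ts
  have hts_mem : tstar ∈ Icc a T := ⟨hats.le, hts_hi.trans hTT.le⟩
  set ts : Icc a T := ⟨tstar, hts_mem⟩
  have hRmin_ts : ∀ y : M, Rmin ≤ (h tstar).scalarCurvatureWith (cov tstar) y :=
    fun y ↦ hRmin tstar ⟨hs₁ts, hts_hi⟩ y
  /- `H_m`-concentration and `H_m`-centres `z i` of `(y_i, s_i)` at time `t*` -/
  have hm0 : 0 < m := by omega
  have hHc : 𝒳.IsHConcentrated H :=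
    ricciFlowMetricFlow_isHConcentrated hm0 hh hR Set.ordConnected_Icc hflow
  have hzex : ∀ i ∈ ℐ, ∃ z : 𝒳.Slice ts, 𝒳.IsHCenter H z (p i).2 := fun i hi ↦
    hHc.exists_isHCenter (s := ts) (t := (p i).1)
      (by have := (hℐ i hi).1; show tstar ≤ si i; linarith only [this, hδ0]) (p i).2
  haveI : Nonempty (𝒳.Slice ts) := ⟨show 𝒳.Slice ts from x₀⟩
  choose! z hz using hzex
  -- the radii `√(H_m (s_i − t*)) ≤ λ r / 4`
  have hsq32 : Real.sqrt (H * (2 * β)) ≤ 1 / 4 := by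
    have e : H * (2 * β) = 1 / 32 := by linarith only [hHβ]
    rw [e]
    calc Real.sqrt (1 / 32) ≤ Real.sqrt ((1 / 4) ^ 2) := Real.sqrt_le_sqrt (by norm_num)
      _ = 1 / 4 := Real.sqrt_sq (by norm_num)
  have hrad : ∀ i ∈ ℐ, (ENNReal.ofReal (H * (si i - tstar))) ^ (1 / 2 : ℝ) ≤
      ENNReal.ofReal (l * r / 4) := by
    intro i hi
    have h1 := ofReal_mul_rpow_half_le_ofReal_sqrt_mul (H := H) (Θ := 2 * β) (ρ := l * r) hH0.le
      (by linarith only [(hℐ i hi).1, hδ0]) (by positivity)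
      (by rw [hlr2]; linarith only [(hℐ i hi).2, hδ] : si i - tstar ≤ 2 * β * (l * r) ^ 2)
    refine h1.trans (ENNReal.ofReal_le_ofReal ?_)
    calc Real.sqrt (H * (2 * β)) * (l * r) ≤ 1 / 4 * (l * r) :=
          mul_le_mul_of_nonneg_right hsq32 (by positivity)
      _ = l * r / 4 := by ring
  /- the balls `B_i = B_{t*}(z_i, λ r / 4)` are pairwise disjoint -/
  set B : Fin N → Set M := fun i ↦
    {w | (h tstar).edist (hR tstar) (z i) w < ENNReal.ofReal (l * r / 4)} with hB
  have hBm : ∀ i, MeasurableSet (B i) := fun i ↦ by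
    have hdc : Continuous fun w ↦ (h tstar).edist (hR tstar) (z i) w :=
      ((h tstar).continuous_edist (hR tstar)).comp (.prodMk_right (z i))
    exact measurableSet_lt hdc.measurable measurable_const
  have hWsep : ∀ i ∈ ℐ, ∀ j ∈ ℐ, i ≠ j → ENNReal.ofReal (l * r) ≤
      wassersteinW1 (𝒳.condKernel (p i).2 ts) (𝒳.condKernel (p j).2 ts) := by
    intro i hi j hj hij
    have h1 := hℐ i hi
    have h2 := hℐ j hj
    exact hHc.ofReal_le_wassersteinW1_of_disjoint_pParabolicBall (mul_pos hl hr) (hdisj i j hij)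
      (t := ts) (by show si i - (l * r) ^ 2 ≤ tstar; linarith only [h1.2, h2δ, hlr2])
      (by show tstar ≤ si i; linarith only [h1.1, hδ0])
      (by show tstar ≤ si j; linarith only [h2.1, hδ0])
      (by show si j ≤ si i + (l * r) ^ 2; linarith only [h1.1, h2.2, h2δ, hlr2, hδ0.le])
  have hsum4 : ENNReal.ofReal (l * r / 4) + (ENNReal.ofReal (l * r / 4) + ENNReal.ofReal (l * r / 4)) +
      ENNReal.ofReal (l * r / 4) = ENNReal.ofReal (l * r) := by
    have h4 : (0 : ℝ) ≤ l * r / 4 := by positivity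
    rw [← ENNReal.ofReal_add h4 h4, ← ENNReal.ofReal_add h4 (by positivity),
      ← ENNReal.ofReal_add (by positivity) h4]
    congr 1
    ring
  have hBdisj : ∀ i ∈ ℐ, ∀ j ∈ ℐ, i ≠ j → Disjoint (B i) (B j) := by
    intro i hi j hj hij
    refine Set.disjoint_left.2 fun w hwi hwj ↦ ?_
    have hwi' : edist (z i) (show 𝒳.Slice ts from w) < ENNReal.ofReal (l * r / 4) := hwi
    have hwj' : edist (z j) (show 𝒳.Slice ts from w) < ENNReal.ofReal (l * r / 4) := hwj
    have hzz : edist (z i) (z j) < ENNReal.ofReal (l * r / 4) + ENNReal.ofReal (l * r / 4) :=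
      (edist_triangle_right (z i) (z j) (show 𝒳.Slice ts from w)).trans_lt
        (ENNReal.add_lt_add hwi' hwj')
    have hW := (hz i hi).wassersteinW1_condKernel_le_edist_add (hz j hj)
    have hlt : wassersteinW1 (𝒳.condKernel (p i).2 ts) (𝒳.condKernel (p j).2 ts) <
        ENNReal.ofReal (l * r) := by
      refine hW.trans_lt ?_
      rw [← hsum4]
      exact ENNReal.add_lt_add_of_lt_of_le (ne_top_of_le_ne_top ENNReal.ofReal_ne_top (hrad j hj))
        (ENNReal.add_lt_add_of_le_of_lt (ne_top_of_le_ne_top ENNReal.ofReal_ne_top (hrad i hi))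
          (hrad i hi) hzz) (hrad j hj)
    exact absurd (hWsep i hi j hj hij) (not_le.2 hlt)
  /- lower volume bound for each ball (Thm. 6.2, Prop. 5.2, Cor. 5.11) -/
  set N₁ : ℝ := pointedNashEntropy h (fun r' v ↦ hflow.heatKernelFn hh hR t₀ x₀ (v, r')) m t₀ s₁
    with hN₁
  have hlow : ∀ i ∈ ℐ, ENNReal.ofReal (c₆ * c₈ * (l ^ m * r ^ m) * Real.exp N₁) ≤
      (h tstar).riemVolume (B i) := by
    intro i hi
    obtain ⟨hδi, h2δi⟩ := hℐ i hi
    have hτ0 : 0 < si i - tstar := hδ0.trans_le hδi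
    have htsi : tstar < si i := sub_pos.1 hτ0
    have hτslab : si i - tstar ≤ (Tm + 2 * l₀ ^ 2 + Tp) * r ^ 2 := by
      rw [← hslab]
      linarith only [(hpt i).2, hs₁ts]
    -- Thm. 6.2 at the `H_m`-centre `z i`
    have hzK : ∫⁻ w, (h tstar).edist (hR tstar) (z i) w ^ 2
        ∂(heatKernelMeasure hh hR (si i) (p i).2 tstar) ≤ ENNReal.ofReal (H * (si i - tstar)) :=
      (hz i hi).lintegral_edist_sq_le
    have h62 := riemVolume_ball_ge_of_hCenter hflow hh hR hm hats htsi (hsiT i) ((p i).2) (z i)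
      hzK hRmin_ts
    have hradius : Real.sqrt (2 * (H * (si i - tstar))) ≤ l * r / 4 := by
      have h1 : 2 * (H * (si i - tstar)) ≤ (l * r / 4) ^ 2 := by
        have h3 : H * (si i - tstar) ≤ H * (2 * δ) := mul_le_mul_of_nonneg_left h2δi.le hH0.le
        have h4 : H * (2 * δ) = l ^ 2 * r ^ 2 / 32 := by
          rw [hδ]
          linear_combination (2 * l ^ 2 * r ^ 2) * hHβ
        nlinarith only [h3, h4]
      calc Real.sqrt (2 * (H * (si i - tstar))) ≤ Real.sqrt ((l * r / 4) ^ 2) :=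
            Real.sqrt_le_sqrt h1
        _ = l * r / 4 := Real.sqrt_sq (by positivity)
    have hsub : {y | (h tstar).edist (hR tstar) (z i) y <
        ENNReal.ofReal (Real.sqrt (2 * (H * (si i - tstar))))} ⊆ B i :=
      fun y hy ↦ lt_of_lt_of_le hy (ENNReal.ofReal_le_ofReal hradius)
    refine le_trans (ENNReal.ofReal_le_ofReal ?_) (h62.trans (measure_mono hsub))
    -- (a) the power of the scale
    have hpow : (4 * Real.pi * β) ^ ((m : ℝ) / 2) * (l ^ m * r ^ m) ≤
        (4 * Real.pi * (si i - tstar)) ^ ((m : ℝ) / 2) := by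
      have e : (4 * Real.pi * δ) ^ ((m : ℝ) / 2) =
          (4 * Real.pi * β) ^ ((m : ℝ) / 2) * (l ^ m * r ^ m) := by
        rw [hδ, show 4 * Real.pi * (β * l ^ 2 * r ^ 2) = (4 * Real.pi * β) * (l ^ 2 * r ^ 2) by
          ring, Real.mul_rpow (x := 4 * Real.pi * β) (y := l ^ 2 * r ^ 2) (by positivity)
          (by positivity), Real.mul_rpow (x := l ^ 2) (y := r ^ 2) hl2.le hr2.le,
          sq_rpow_natCast_div_two hl.le, sq_rpow_natCast_div_two hr.le]
      rw [← e]
      exact Real.rpow_le_rpow (by positivity)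
        (mul_le_mul_of_nonneg_left hδi (by positivity)) (by positivity)
    -- (b) the scalar curvature factor
    have hexpR : Real.exp (-2 * Real.sqrt ((m : ℝ) + 2 * Λ)) ≤
        Real.exp (-2 * Real.sqrt ((m : ℝ) - 2 * Rmin * (si i - tstar))) := by
      refine Real.exp_le_exp.2 ?_
      have hb' := hbudget (si i - tstar) hτ0.le hτslab
      have : Real.sqrt ((m : ℝ) - 2 * Rmin * (si i - tstar)) ≤ Real.sqrt ((m : ℝ) + 2 * Λ) :=
        Real.sqrt_le_sqrt (by linarith only [hb'])
      linarith only [this]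
    -- (c) the entropy factor
    have hent : c₈ * Real.exp N₁ ≤ Real.exp (pointedNashEntropy h
        (fun r' v ↦ hflow.heatKernelFn hh hR (si i) (p i).2 (v, r')) m (si i) tstar) := by
      have hW' : (letI := (h s₀).metricSpace (hR s₀)
          wassersteinW1 (heatKernelMeasure hh hR t₀ x₀ s₀)
            (heatKernelMeasure hh hR (si i) (p i).2 s₀)) ≤ ENNReal.ofReal (A * r) := (hpW i).le
      have h1 := kernelNashEntropy_sub_le_kernelNashEntropy_of_wassersteinW1_le hflow hh hR hm
        hs₁a hs₁₀ hs₀t₀ (hpt i).1 ht₀T (hsiT i) hs₁ts htsi hRmin₁ x₀ (p i).2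
        (by positivity : 0 ≤ A * r) hW'
      have hlog : Real.log ((si i - s₁) / (s₀ - s₁)) ≤ Real.log Q := by
        have hnum : 0 < si i - s₁ := by linarith only [(hpt i).1, hs₁₀]
        refine Real.log_le_log (div_pos hnum (by linarith only [hs₁₀])) ?_
        rw [hQ, hs₁s₀, div_le_div_iff₀ (by positivity) (by positivity)]
        have : si i - s₁ ≤ (Tm + Tp + 2 * l₀ ^ 2) * r ^ 2 := by
          linarith only [(hpt i).2, hslab, hs₁ts, htsi]
        nlinarith only [this, hl₀2, hr2, hnum]
      have hL : Real.sqrt ((m : ℝ) / (2 * (s₀ - s₁)) - Rmin) * (A * r) ≤ E₁ := by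
        have hρ1 : 0 < s₀ - s₁ := by linarith only [hs₁₀]
        have hLρ : Real.sqrt ((m : ℝ) / (2 * (s₀ - s₁)) - Rmin) * Real.sqrt (s₀ - s₁) ≤
            Real.sqrt ((m : ℝ) / 2 + Λ) := by
          refine sqrt_mul_sqrt_le_sqrt_of_le_div hρ1 ?_
          have e : (m : ℝ) / (2 * (s₀ - s₁)) * (s₀ - s₁) = (m : ℝ) / 2 := by field_simp
          rw [le_div_iff₀ hρ1, sub_mul, e]
          have hb' := hbudget (s₀ - s₁) hρ1.le
            (by rw [hs₁s₀]; nlinarith only [hTm, hTp, hr2, hl₀2])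
          linarith only [hb']
        have hsq : Real.sqrt (s₀ - s₁) = Real.sqrt (2 * l₀ ^ 2) * r := by
          rw [hs₁s₀, Real.sqrt_mul (by positivity), Real.sqrt_sq hr.le]
        rw [hsq] at hLρ
        have hpos : 0 < Real.sqrt (2 * l₀ ^ 2) := Real.sqrt_pos.2 (by positivity)
        rw [hE₁, div_mul_eq_mul_div, le_div_iff₀ hpos]
        calc Real.sqrt ((m : ℝ) / (2 * (s₀ - s₁)) - Rmin) * (A * r) * Real.sqrt (2 * l₀ ^ 2)
            = Real.sqrt ((m : ℝ) / (2 * (s₀ - s₁)) - Rmin) * (Real.sqrt (2 * l₀ ^ 2) * r) * A := by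
              ring
          _ ≤ Real.sqrt ((m : ℝ) / 2 + Λ) * A := mul_le_mul_of_nonneg_right hLρ hA
      have hm2 : 0 ≤ (m : ℝ) / 2 := by positivity
      have h3 := mul_le_mul_of_nonneg_left hlog hm2
      have h2 : N₁ - ((m : ℝ) / 2 * Real.log Q + E₁) ≤ pointedNashEntropy h
          (fun r' v ↦ hflow.heatKernelFn hh hR (si i) (p i).2 (v, r')) m (si i) tstar := by
        linarith only [h1, h3, hL]
      calc c₈ * Real.exp N₁ = Real.exp (N₁ - ((m : ℝ) / 2 * Real.log Q + E₁)) := by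
            rw [hc₈, ← Real.exp_add]
            congr 1
            ring
        _ ≤ _ := Real.exp_le_exp.2 h2
    -- combine
    have hem0 : 0 ≤ Real.exp ((m : ℝ) / 2) := (Real.exp_pos _).le
    calc c₆ * c₈ * (l ^ m * r ^ m) * Real.exp N₁
        = 1 / 2 * ((4 * Real.pi * β) ^ ((m : ℝ) / 2) * (l ^ m * r ^ m)) * Real.exp ((m : ℝ) / 2) *
            Real.exp (-2 * Real.sqrt ((m : ℝ) + 2 * Λ)) * (c₈ * Real.exp N₁) := by
          rw [hc₆]; ring
      _ ≤ 1 / 2 * (4 * Real.pi * (si i - tstar)) ^ ((m : ℝ) / 2) * Real.exp ((m : ℝ) / 2) *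
            Real.exp (-2 * Real.sqrt ((m : ℝ) - 2 * Rmin * (si i - tstar))) *
            Real.exp (pointedNashEntropy h (fun r' v ↦ hflow.heatKernelFn hh hR (si i) (p i).2
              (v, r')) m (si i) tstar) := by
          refine mul_le_mul ?_ hent (by positivity) (by positivity)
          refine mul_le_mul ?_ hexpR (by positivity) (by positivity)
          exact mul_le_mul_of_nonneg_right (mul_le_mul_of_nonneg_left hpow (by norm_num)) hem0
  /- all balls lie in the time-`t*` slice of `P*(x₀, t₀; (A + λ₀) r, −(T⁻ + λ₀²) r², T⁺ r²)` -/
  set S' : Set M := 𝒳.pParabolicNhdSlice ⟨⟨t₀, ht₀⟩, x₀⟩ ((A + l₀) * r) ((Tm + l₀ ^ 2) * r ^ 2)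
    (Tp * r ^ 2) hsm_mem ts with hS'
  have e₁ : t₀ - (Tm + l₀ ^ 2 + l₀ ^ 2) * r ^ 2 = s₁ := by rw [hs₁]; ring
  have hVOL := VOL hflow hh hR ht₀ hts_mem hsm_mem hr (by rw [e₁]; exact hs₁a)
    ((hsms₀.trans hs₀t₀).trans_lt ht₀T) (Rmin := Rmin)
    (fun s hs y ↦ hRmin s ⟨by rw [← e₁]; exact hs.1, hs.2.trans hts_hi⟩ y)
    (by rw [e₁]; exact hbudget _ (sub_nonneg.2 hs₁ts) (by linarith only [hts_hi, hslab])) x₀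
  rw [e₁] at hVOL
  have hBS : ∀ i ∈ ℐ, B i ⊆ S' := by
    intro i hi w hw
    have hw' : edist (z i) (show 𝒳.Slice ts from w) ≤ ENNReal.ofReal (l * r / 4) := le_of_lt hw
    show (show 𝒳.Slice ts from w) ∈ 𝒳.pParabolicNhdSlice ⟨⟨t₀, ht₀⟩, x₀⟩ ((A + l₀) * r)
      ((Tm + l₀ ^ 2) * r ^ 2) (Tp * r ^ 2) hsm_mem ts
    refine MetricFlow.mem_pParabolicNhdSlice_iff.2 ⟨⟨?_, ?_⟩, ?_⟩
    · show t₀ - (Tm + l₀ ^ 2) * r ^ 2 ≤ tstar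
      exact hsmts
    · show tstar ≤ t₀ + Tp * r ^ 2
      exact hts_hi
    · have hG := hHc.wassersteinW1_condKernel_le_of_isHCenter (sm := ⟨sm, hsm_mem⟩) (s₀ := sb)
        (t₀ := ⟨t₀, ht₀⟩) (x₀ := x₀) (hz i hi) (show 𝒳.Slice ts from w) hsms₀ hs₀t₀ (hpt i).1
        hsmts
      refine hG.trans_lt ?_
      calc wassersteinW1 (𝒳.condKernel (t := ⟨t₀, ht₀⟩) x₀ sb) (𝒳.condKernel (p i).2 sb) +
            (ENNReal.ofReal (H * (si i - tstar))) ^ (1 / 2 : ℝ) +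
            edist (z i) (show 𝒳.Slice ts from w)
          < ENNReal.ofReal (A * r) + ENNReal.ofReal (l * r / 4) + ENNReal.ofReal (l * r / 4) :=
            ENNReal.add_lt_add_of_lt_of_le (edist_ne_top _ _)
              (ENNReal.add_lt_add_of_lt_of_le
                (ne_top_of_le_ne_top ENNReal.ofReal_ne_top (hrad i hi)) (hpW i) (hrad i hi)) hw'
        _ = ENNReal.ofReal ((A + l / 2) * r) := by
            rw [← ENNReal.ofReal_add (by positivity) (by positivity),
              ← ENNReal.ofReal_add (by positivity) (by positivity)]
            congr 1
            ring
        _ ≤ ENNReal.ofReal ((A + l₀) * r) :=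
            ENNReal.ofReal_le_ofReal (by nlinarith only [hll₀, hr, hl])
  have hU : (⋃ i ∈ ℐ, B i) ⊆ S' := Set.iUnion₂_subset hBS
  haveI : IsFiniteMeasure (h tstar).riemVolume := ⟨(h tstar).riemVolume_univ_lt_top⟩
  have hsumV : ∑ i ∈ ℐ, (h tstar).riemVolume (B i) ≤
      ENNReal.ofReal (CS * r ^ m * Real.exp N₁) := by
    rw [← measure_biUnion_finset (fun i hi j hj hij ↦ hBdisj i hi j hj hij) (fun i _ ↦ hBm i)]
    refine (measure_mono hU).trans ?_
    rw [← ofReal_measureReal (measure_ne_top _ _)]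
    exact ENNReal.ofReal_le_ofReal hVOL
  have hcardE : (ℐ.card : ℝ≥0∞) * ENNReal.ofReal (c₆ * c₈ * (l ^ m * r ^ m) * Real.exp N₁) ≤
      ENNReal.ofReal (CS * r ^ m * Real.exp N₁) := by
    calc (ℐ.card : ℝ≥0∞) * ENNReal.ofReal (c₆ * c₈ * (l ^ m * r ^ m) * Real.exp N₁)
        = ∑ i ∈ ℐ, ENNReal.ofReal (c₆ * c₈ * (l ^ m * r ^ m) * Real.exp N₁) := by
          rw [Finset.sum_const, nsmul_eq_mul]
      _ ≤ ∑ i ∈ ℐ, (h tstar).riemVolume (B i) := Finset.sum_le_sum hlow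
      _ ≤ _ := hsumV
  have hcard : (ℐ.card : ℝ) * (c₆ * c₈ * (l ^ m * r ^ m) * Real.exp N₁) ≤
      CS * r ^ m * Real.exp N₁ := by
    rw [← ENNReal.ofReal_le_ofReal_iff (by positivity), ENNReal.ofReal_mul (Nat.cast_nonneg _),
      ENNReal.ofReal_natCast]
    exact hcardE
  /- conclusion -/
  have hcard' : (ℐ.card : ℝ) * l ^ m ≤ CS / (c₆ * c₈) := by
    rw [le_div_iff₀ (by positivity)]
    have hpos : 0 < r ^ m * Real.exp N₁ := by positivity
    have h' : (ℐ.card : ℝ) * l ^ m * (c₆ * c₈) * (r ^ m * Real.exp N₁) ≤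
        CS * (r ^ m * Real.exp N₁) := by
      calc (ℐ.card : ℝ) * l ^ m * (c₆ * c₈) * (r ^ m * Real.exp N₁)
          = (ℐ.card : ℝ) * (c₆ * c₈ * (l ^ m * r ^ m) * Real.exp N₁) := by ring
        _ ≤ CS * r ^ m * Real.exp N₁ := hcard
        _ = CS * (r ^ m * Real.exp N₁) := by ring
    exact le_of_mul_le_mul_right h' hpos
  have hK : (t₀ + Tp * r ^ 2 - s₀) / δ + 2 ≤ K₁ / l ^ 2 := by
    have e : (t₀ + Tp * r ^ 2 - s₀) / δ = (Tm + Tp) / β / l ^ 2 := by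
      rw [hδ, hs₀]
      field_simp
      ring
    rw [e, hK₁, le_div_iff₀ hl2, add_mul, div_mul_cancel₀ _ hl2.ne']
    linarith only [hll]
  have hN : (N : ℝ) ≤ K₁ / l ^ 2 * ℐ.card :=
    hNle.trans (mul_le_mul_of_nonneg_right hK (Nat.cast_nonneg _))
  calc (N : ℝ) * l ^ (m + 2) ≤ K₁ / l ^ 2 * ℐ.card * l ^ (m + 2) :=
        mul_le_mul_of_nonneg_right hN (by positivity)
    _ = K₁ * ((ℐ.card : ℝ) * l ^ m) := by
        rw [pow_add]
        field_simp
    _ ≤ K₁ * (CS / (c₆ * c₈)) := mul_le_mul_of_nonneg_left hcard' hK₁0.le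
    _ = K₁ * CS / (c₆ * c₈) := (mul_div_assoc _ _ _).symm

end Literature.Geometry.Riemannian

end
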